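import Summits.AtomisticToContinuum.BoseEinsteinCondensation.Theorems.BECHeatBathGapSquareSummableInfluenceBlindApproxReduction
import Summits.AtomisticToContinuum.BoseEinsteinCondensation.Theorems.BECHeatBathGapSomeNearMinimiserCondenses
import Literature.MathematicalPhysics.QuantumManyBody.LiebYngvasonBoxBound
import Mathlib.Analysis.InnerProductSpace.Projection.Basic
import HarnessLib

/-!
# Route `BECHeatBathGap`, crux `SquareSummableInfluence` (stmt-AtomisticToContinuum-14368), line `registered`:
# the OPTIMAL blind predictor (fibrewise conditional least squares) and the predictor-free form of the leaf

Supports (does not close) stmt-AtomisticToContinuum-14368 (lead c5). The crux A2 and its registered physics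
leaf `stub_allGroundStatesInfluence` quantify over bounded measurable predictors `g_i(Z)` BLIND to the bath
particle `x_i = Z (succ i)` and ask for a small total influence `∑_i ∫_{Λ^{N+1}} |Ψ(Z) − g_i(Z) Θ(tail Z)|²`.
This file removes that quantifier: for measurable, square-integrable `Θ` (bath, `N` bodies) and `Ψ`
(`N + 1` bodies) the infimum over blind predictors is ATTAINED in closed form, fibre by fibre in the
coordinate `x_i`, by the conditional least-squares amplitude

`g⋆_i(Z) = ∫_{Λ} conj Θ(tail Z^{i→x}) Ψ(Z^{i→x}) dx / ∫_{Λ} |Θ(tail Z^{i→x})|² dx`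

(`Z^{i→x}` = `Z` with `Z (succ i)` replaced by `x`; `g⋆_i = 0` on fibres of zero or infinite `Θ`-mass), the
orthogonal projection of `Ψ(Z^{i→·})` onto the line `ℂ Θ(tail Z^{i→·})` in `L²(Λ, dx_i)`:

* `lintegral_sub_leastSquares_mul_tail_sq_le` — for EVERY measurable blind `g`,
  `∫ |Ψ − g⋆_i Θ(tail)|² ≤ ∫ |Ψ − g Θ(tail)|²` (least squares on a.e. fibre, `lintegral_sub_leastSquares_mul_sq_le`,
  glued by the one-coordinate marginal identity `lintegral_lmarginal_singleton`:
  `∫ (∫⋯∫⁻_{j} F) d(⨂μ) = μ_j(univ) ∫ F d(⨂μ)`);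
* `exists_bounded_blind_lintegral_le_leastSquares_add` — conversely, for every `η > 0` a BOUNDED measurable
  blind predictor (a truncation of `g⋆_i`) comes within `η` of the least-squares defect (dominated
  convergence of the tail masses `∫_{|g⋆_i| > n} |Ψ|²`);
* (sequel file `…LeastSquaresLeaf.lean`) hence the registered leaf is EQUIVALENT to its predictor-free form
  `∑_i ∫_{Λ^{N+1}} |Ψ₀ − g⋆_i Θ₀(tail)|² ≤ ε`, and that form implies the crux BY NAME.

The same lemma serves crux A1 (`ParticleTensorisation`), whose right-hand side `∑_i ∫ |F − g_i Θ|²` over blind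
`g_i` is minimised by the same `g⋆_i`. No new definitions (the predictor is written out); `[folklore]`
(least squares / conditional expectation as an `L²` projection).
-/

noncomputable section

open MeasureTheory Filter Function
open scoped ENNReal NNReal Topology ComplexConjugate InnerProductSpace

namespace Summit.AtomisticToContinuum.BoseEinsteinCondensation.Theorems.SquareSummableInfluence

open Literature.MathematicalPhysics.QuantumManyBody.BoseGas

/-! ### One fibre: the least-squares coefficient beats every constant -/

/-- **Least squares on one fibre.** In `L²(μ; ℂ)`, for square-integrable `ψ, θ` the coefficient
`c⋆ = (∫ conj θ · ψ) / ∫ |θ|²` (with `c⋆ = 0` when `∫|θ|² = 0`, Lean's `x / 0 = 0`) minimises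
`c ↦ ∫ |ψ − c θ|²`: `∫ |ψ − c⋆ θ|² ≤ ∫ |ψ − c θ|²` for every `c ∈ ℂ` (orthogonal projection onto the line
`ℂ θ`). [folklore] -/
theorem lintegral_sub_leastSquares_mul_sq_le {α : Type*} [MeasurableSpace α] {μ : Measure α}
    {ψ θ : α → ℂ} (hψ : AEStronglyMeasurable ψ μ) (hθ : AEStronglyMeasurable θ μ)
    (hψ2 : ∫⁻ x, (‖ψ x‖₊ : ℝ≥0∞) ^ 2 ∂μ ≠ ⊤) (hθ2 : ∫⁻ x, (‖θ x‖₊ : ℝ≥0∞) ^ 2 ∂μ ≠ ⊤) (c : ℂ) :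
    ∫⁻ x, (‖ψ x - (∫ y, conj (θ y) * ψ y ∂μ) / (((∫⁻ y, (‖θ y‖₊ : ℝ≥0∞) ^ 2 ∂μ).toReal : ℝ) : ℂ) *
        θ x‖₊ : ℝ≥0∞) ^ 2 ∂μ ≤
      ∫⁻ x, (‖ψ x - c * θ x‖₊ : ℝ≥0∞) ^ 2 ∂μ := by
  have hψL : MemLp ψ 2 μ := memLp_two_of_lintegral_ne_top hψ hψ2
  have hθL : MemLp θ 2 μ := memLp_two_of_lintegral_ne_top hθ hθ2
  set Ψ' := hψL.toLp ψ with hΨ'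
  set Θ' := hθL.toLp θ with hΘ'
  set cs : ℂ := (∫ y, conj (θ y) * ψ y ∂μ) / (((∫⁻ y, (‖θ y‖₊ : ℝ≥0∞) ^ 2 ∂μ).toReal : ℝ) : ℂ)
    with hcs
  -- the projection of `Ψ'` onto the line `ℂ Θ'` is `cs • Θ'`
  have hproj : (ℂ ∙ Θ').starProjection Ψ' = cs • Θ' := by
    rw [Submodule.starProjection_singleton ℂ Ψ', inner_toLp_eq_integral_conj_mul hψL hθL,
      norm_toLp_sq_eq_toReal_lintegral hθL]
    rfl
  -- minimality of the projection among the points of the line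
  have hmin : ‖Ψ' - cs • Θ'‖ ≤ ‖Ψ' - c • Θ'‖ := by
    rw [← hproj, Submodule.starProjection_minimal]
    have hmem : c • Θ' ∈ (ℂ ∙ Θ') := Submodule.smul_mem _ c (Submodule.mem_span_singleton_self Θ')
    exact ciInf_le_of_le ⟨0, fun r ⟨w, hw⟩ => hw ▸ norm_nonneg _⟩ ⟨c • Θ', hmem⟩ le_rfl
  -- translate the two `L²` norms into lower Lebesgue integrals
  have hD : ∀ a : ℂ, MemLp (ψ - a • θ) 2 μ := fun a => hψL.sub (hθL.const_smul a)
  have hnorm : ∀ a : ℂ, ‖Ψ' - a • Θ'‖ ^ 2 =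
      (∫⁻ x, (‖ψ x - a * θ x‖₊ : ℝ≥0∞) ^ 2 ∂μ).toReal := by
    intro a
    rw [hΨ', hΘ', ← MemLp.toLp_const_smul, ← MemLp.toLp_sub, norm_toLp_sq_eq_toReal_lintegral (hD a)]
    simp only [Pi.sub_apply, Pi.smul_apply, smul_eq_mul]
  have hfin : ∀ a : ℂ, ∫⁻ x, (‖ψ x - a * θ x‖₊ : ℝ≥0∞) ^ 2 ∂μ ≠ ⊤ := by
    intro a
    have h := lintegral_rpow_enorm_lt_top_of_eLpNorm_lt_top two_ne_zero ENNReal.ofNat_ne_top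
      (hD a).eLpNorm_lt_top
    rw [ENNReal.toReal_ofNat] at h
    simp_rw [enorm_eq_nnnorm, ENNReal.rpow_two, Pi.sub_apply, Pi.smul_apply, smul_eq_mul] at h
    exact h.ne
  have hsq : ‖Ψ' - cs • Θ'‖ ^ 2 ≤ ‖Ψ' - c • Θ'‖ ^ 2 := pow_le_pow_left₀ (norm_nonneg _) hmin 2
  rw [hnorm, hnorm] at hsq
  exact (ENNReal.toReal_le_toReal (hfin cs) (hfin c)).1 hsq

/-! ### Product-measure bookkeeping: integrating a one-coordinate marginal -/

/-- Integrating the one-coordinate marginal `∫⋯∫⁻_{j}, f` against the full product measure counts the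
coordinate `j` twice: `∫ (∫⋯∫⁻_{j}, f ∂μ) ∂(⨂ μ) = μ_j(univ) · ∫ f ∂(⨂ μ)`. [folklore] -/
theorem lintegral_lmarginal_singleton {δ : Type*} [Fintype δ] [DecidableEq δ] {X : δ → Type*}
    [∀ i, MeasurableSpace (X i)] (μ : ∀ i, Measure (X i)) [∀ i, SigmaFinite (μ i)] (j : δ)
    {f : (∀ i, X i) → ℝ≥0∞} (hf : Measurable f) :
    ∫⁻ x, (∫⋯∫⁻_{j}, f ∂μ) x ∂Measure.pi μ = μ j Set.univ * ∫⁻ x, f x ∂Measure.pi μ := by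
  rcases isEmpty_or_nonempty (∀ i, X i) with h | ⟨⟨x₀⟩⟩
  · simp [lintegral_of_isEmpty]
  have hG : Measurable (∫⋯∫⁻_{j}, f ∂μ) := hf.lmarginal μ
  rw [lintegral_eq_lmarginal_univ x₀, lintegral_eq_lmarginal_univ x₀,
    lmarginal_erase' _ hG (Finset.mem_univ j), lmarginal_erase' _ hf (Finset.mem_univ j)]
  have h1 : (fun x => ∫⁻ y, (∫⋯∫⁻_{j}, f ∂μ) (Function.update x j y) ∂μ j) =
      fun x => μ j Set.univ * (∫⋯∫⁻_{j}, f ∂μ) x := by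
    funext x
    simp only [lmarginal_update_of_mem μ (Finset.mem_singleton_self j)]
    rw [lintegral_const, mul_comm]
  have h2 : (fun x => ∫⁻ y, f (Function.update x j y) ∂μ j) = ∫⋯∫⁻_{j}, f ∂μ :=
    (lmarginal_singleton f j).symm
  rw [h1, h2]
  -- a constant multiple comes out of the remaining marginal
  unfold lmarginal
  exact lintegral_const_mul _ (hG.comp measurable_updateFinset)

/-- On the `n`-particle box: `∫_{Λ_L^n} (∫⋯∫⁻_{j}, F)(Z) dZ = |Λ_L| · ∫_{Λ_L^n} F` for measurable `F ≥ 0`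
(the marginal is taken in the box product measure). [folklore] -/
theorem setLIntegral_boxN_lmarginal_singleton (n : ℕ) (L : ℝ) (j : Fin n)
    {F : Config n → ℝ≥0∞} (hF : Measurable F) :
    ∫⁻ Z in boxN n L, (∫⋯∫⁻_{j}, F ∂fun _ : Fin n => (volume : Measure Space).restrict (box L)) Z =
      ENNReal.ofReal L ^ 3 * ∫⁻ Z in boxN n L, F Z := by
  rw [volume_restrict_boxN_eq_pi, lintegral_lmarginal_singleton _ j hF, Measure.restrict_apply_univ,
    volume_box]

/-! ### Bookkeeping on the boxes -/

/-- For `L ≤ 0` the box `Λ_L^{n+1}` is empty. [folklore] -/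
theorem boxN_succ_eq_empty_of_nonpos {n : ℕ} {L : ℝ} (hL : L ≤ 0) : boxN (n + 1) L = ∅ := by
  ext Z
  simp only [boxN, box, Set.mem_setOf_eq, Set.mem_Ioo, Set.mem_empty_iff_false, iff_false, not_forall]
  exact ⟨0, 0, fun h => by linarith [h.1, h.2]⟩

/-- `∫_{Λ_L^{N+1}} G(tail Z) dZ = |Λ_L| · ∫_{Λ_L^N} G` for measurable `G ≥ 0` (the inserted particle
integrates out). [folklore] -/
theorem setLIntegral_boxN_succ_comp_vecTail {N : ℕ} (L : ℝ) {G : Config N → ℝ≥0∞} (hG : Measurable G) :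
    ∫⁻ Z in boxN (N + 1) L, G (Matrix.vecTail Z) = ENNReal.ofReal L ^ 3 * ∫⁻ X in boxN N L, G X := by
  rw [← setLIntegral_box_boxN_vecCons L (G := fun Z => G (Matrix.vecTail Z)) (hG.comp measurable_vecTail)]
  simp only [Matrix.tail_cons]
  rw [setLIntegral_const, volume_box, mul_comm]

/-! ### The optimal blind predictor: fibrewise conditional least squares -/

/-- **The least-squares predictor beats every blind predictor (predictor-free lower bound for the
influence of one bath particle).** Let `Θ : Λ_L^N → ℂ` (bath amplitude) and `Ψ : Λ_L^{N+1} → ℂ` (bath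
plus the inserted particle `Z 0`) be measurable and square integrable on the boxes, and `i` a bath label.
On the fibre of the bath coordinate `x_i = Z (succ i)` through `Z` put
`m_i(Z) = ∫_{Λ_L} |Θ(tail Z^{i→x})|² dx`, `o_i(Z) = ∫_{Λ_L} conj Θ(tail Z^{i→x}) Ψ(Z^{i→x}) dx` and the
**least-squares (conditional-mean) predictor** `g⋆_i(Z) = o_i(Z) / m_i(Z)` (`= 0` where `m_i ∈ {0, ∞}`) —
it is blind to `x_i`. Then for EVERY measurable predictor `g` blind to `x_i`,
`∫_{Λ_L^{N+1}} |Ψ − g⋆_i Θ(tail)|² ≤ ∫_{Λ_L^{N+1}} |Ψ − g Θ(tail)|²`: the infimum over blind predictors in the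
crux `SquareSummableInfluence` / card A2 is attained, fibre by fibre, by orthogonal projection onto the line
`ℂ Θ(tail Z^{i→·})` in `L²(Λ_L, dx_i)` (for `Θ > 0` this is `‖(1 − P_i)Ψ‖² = ∫dy E_{Θ²}[Var_i(Ψ/Θ)]`, the
conditional-variance form of the influence). Proof: least squares on a.e. fibre
(`lintegral_sub_leastSquares_mul_sq_le`; the fibres with infinite mass are null by Tonelli) and
integration of the one-coordinate marginals (`lintegral_lmarginal_singleton`). [folklore] -/
theorem lintegral_sub_leastSquares_mul_tail_sq_le :
    ∀ (N : ℕ) (L : ℝ) (Θ : Config N → ℂ) (Ψ : Config (N + 1) → ℂ), Measurable Θ → Measurable Ψ →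
      (∫⁻ X in boxN N L, (‖Θ X‖₊ : ℝ≥0∞) ^ 2) ≠ ⊤ →
      (∫⁻ Z in boxN (N + 1) L, (‖Ψ Z‖₊ : ℝ≥0∞) ^ 2) ≠ ⊤ → ∀ (i : Fin N) (g : Config (N + 1) → ℂ),
      Measurable g → (∀ Z x, g (Function.update Z (Fin.succ i) x) = g Z) →
    (∫⁻ Z in boxN (N + 1) L, (‖Ψ Z -
        ((∫ x in box L, conj (Θ (Matrix.vecTail (Function.update Z (Fin.succ i) x))) *
            Ψ (Function.update Z (Fin.succ i) x)) /
          (((∫⁻ x in box L, (‖Θ (Matrix.vecTail (Function.update Z (Fin.succ i) x))‖₊ : ℝ≥0∞) ^ 2).toReal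
            : ℝ) : ℂ)) *
          Θ (Matrix.vecTail Z)‖₊ : ℝ≥0∞) ^ 2) ≤
      ∫⁻ Z in boxN (N + 1) L, (‖Ψ Z - g Z * Θ (Matrix.vecTail Z)‖₊ : ℝ≥0∞) ^ 2 := by
  intro N L Θ Ψ hΘ hΨ hΘ2 hΨ2 i g hg hgi
  -- the empty box
  rcases le_or_gt L 0 with hL | hL
  · simp [boxN_succ_eq_empty_of_nonpos hL]
  -- the fibre maps and the fibrewise objects `m`, `o`, `g⋆`
  set μ : Fin (N + 1) → Measure Space := fun _ => (volume : Measure Space).restrict (box L) with hμ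
  have hU : Measurable fun p : Config (N + 1) × Space => Function.update p.1 (Fin.succ i) p.2 :=
    measurable_update'
  set θt : Config (N + 1) × Space → ℂ := fun p => Θ (Matrix.vecTail (Function.update p.1 (Fin.succ i) p.2))
    with hθt
  set ψt : Config (N + 1) × Space → ℂ := fun p => Ψ (Function.update p.1 (Fin.succ i) p.2) with hψt
  have hθtm : Measurable θt := hΘ.comp (measurable_vecTail.comp hU)
  have hψtm : Measurable ψt := hΨ.comp hU
  set m : Config (N + 1) → ℝ≥0∞ := fun Z => ∫⁻ x in box L, (‖θt (Z, x)‖₊ : ℝ≥0∞) ^ 2 with hm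
  set o : Config (N + 1) → ℂ := fun Z => ∫ x in box L, conj (θt (Z, x)) * ψt (Z, x) with ho
  set gs : Config (N + 1) → ℂ := fun Z => o Z / (((m Z).toReal : ℝ) : ℂ) with hgs
  have hmm : Measurable m := (hθtm.nnnorm.coe_nnreal_ennreal.pow_const 2).lintegral_prod_right'
  have hom : Measurable o := by
    have h : Measurable fun p : Config (N + 1) × Space => conj (θt p) * ψt p :=
      (Complex.continuous_conj.measurable.comp hθtm).mul hψtm
    exact (h.stronglyMeasurable.integral_prod_right' (ν := (volume : Measure Space).restrict (box L))).measurable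
  have hgsm : Measurable gs := hom.div (Complex.measurable_ofReal.comp hmm.ennreal_toReal)
  -- blindness of `m`, `o`, `g⋆`
  have hmi : ∀ Z y, m (Function.update Z (Fin.succ i) y) = m Z := fun Z y => by
    simp only [hm, hθt, Function.update_idem]
  have hoi : ∀ Z y, o (Function.update Z (Fin.succ i) y) = o Z := fun Z y => by
    simp only [ho, hθt, hψt, Function.update_idem]
  have hgsi : ∀ Z y, gs (Function.update Z (Fin.succ i) y) = gs Z := fun Z y => by
    simp only [hgs, hmi, hoi]
  -- the two defect integrands
  set Fs : Config (N + 1) → ℝ≥0∞ := fun Z => (‖Ψ Z - gs Z * Θ (Matrix.vecTail Z)‖₊ : ℝ≥0∞) ^ 2 with hFs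
  set Fg : Config (N + 1) → ℝ≥0∞ := fun Z => (‖Ψ Z - g Z * Θ (Matrix.vecTail Z)‖₊ : ℝ≥0∞) ^ 2 with hFg
  have hΘt : Measurable fun Z : Config (N + 1) => Θ (Matrix.vecTail Z) := hΘ.comp measurable_vecTail
  have hFsm : Measurable Fs := (hΨ.sub (hgsm.mul hΘt)).nnnorm.coe_nnreal_ennreal.pow_const 2
  have hFgm : Measurable Fg := (hΨ.sub (hg.mul hΘt)).nnnorm.coe_nnreal_ennreal.pow_const 2
  change ∫⁻ Z in boxN (N + 1) L, Fs Z ≤ ∫⁻ Z in boxN (N + 1) L, Fg Z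
  -- a.e. fibre has finite `Θ`-mass and finite `Ψ`-mass
  have hL3 : ENNReal.ofReal L ^ 3 ≠ 0 := pow_ne_zero _ (by simpa using hL)
  have hL3' : ENNReal.ofReal L ^ 3 ≠ ⊤ := ENNReal.pow_ne_top ENNReal.ofReal_ne_top
  have hm_eq : (∫⋯∫⁻_{Fin.succ i}, (fun Z => (‖Θ (Matrix.vecTail Z)‖₊ : ℝ≥0∞) ^ 2) ∂μ) = m := by
    rw [lmarginal_singleton]
  have hm_ae : ∀ᵐ Z ∂(volume : Measure (Config (N + 1))).restrict (boxN (N + 1) L), m Z < ⊤ := by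
    refine ae_lt_top hmm ?_
    rw [← hm_eq, setLIntegral_boxN_lmarginal_singleton (N + 1) L (Fin.succ i)
      (hΘt.nnnorm.coe_nnreal_ennreal.pow_const 2), setLIntegral_boxN_succ_comp_vecTail L
      (hΘ.nnnorm.coe_nnreal_ennreal.pow_const 2)]
    exact ENNReal.mul_ne_top hL3' (ENNReal.mul_ne_top hL3' hΘ2)
  set pm : Config (N + 1) → ℝ≥0∞ := fun Z => ∫⁻ x in box L, (‖ψt (Z, x)‖₊ : ℝ≥0∞) ^ 2 with hpm
  have hpmm : Measurable pm := (hψtm.nnnorm.coe_nnreal_ennreal.pow_const 2).lintegral_prod_right'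
  have hp_eq : (∫⋯∫⁻_{Fin.succ i}, (fun Z => (‖Ψ Z‖₊ : ℝ≥0∞) ^ 2) ∂μ) = pm := by
    rw [lmarginal_singleton]
  have hp_ae : ∀ᵐ Z ∂(volume : Measure (Config (N + 1))).restrict (boxN (N + 1) L), pm Z < ⊤ := by
    refine ae_lt_top hpmm ?_
    rw [← hp_eq, setLIntegral_boxN_lmarginal_singleton (N + 1) L (Fin.succ i)
      (hΨ.nnnorm.coe_nnreal_ennreal.pow_const 2)]
    exact ENNReal.mul_ne_top hL3' hΨ2
  -- least squares on every good fibre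
  have hfib : ∀ᵐ Z ∂(volume : Measure (Config (N + 1))).restrict (boxN (N + 1) L),
      (∫⋯∫⁻_{Fin.succ i}, Fs ∂μ) Z ≤ (∫⋯∫⁻_{Fin.succ i}, Fg ∂μ) Z := by
    filter_upwards [hm_ae, hp_ae] with Z hmZ hpZ
    rw [lmarginal_singleton, lmarginal_singleton]
    simp only [hFs, hFg, hgsi, hgi]
    have key := lintegral_sub_leastSquares_mul_sq_le (μ := (volume : Measure Space).restrict (box L))
      (ψ := fun x => ψt (Z, x)) (θ := fun x => θt (Z, x))
      (hψtm.comp measurable_prodMk_left).aestronglyMeasurable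
      (hθtm.comp measurable_prodMk_left).aestronglyMeasurable hpZ.ne hmZ.ne (g Z)
    simpa only [hθt, hψt, hgs, ho, hm] using key
  -- integrate the marginals
  rw [← ENNReal.mul_le_mul_iff_right hL3 hL3', ← setLIntegral_boxN_lmarginal_singleton (N + 1) L (Fin.succ i) hFsm,
    ← setLIntegral_boxN_lmarginal_singleton (N + 1) L (Fin.succ i) hFgm]
  exact lintegral_mono_ae hfib

/-- **The least-squares defect is attained, up to any `η > 0`, by a BOUNDED measurable blind predictor**
(truncate the least-squares predictor `g⋆_i` at a large level `n`: on the fibres where `|g⋆_i| > n` predict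
`0`, which costs at most `∫_{|g⋆_i| > n} |Ψ|² → 0` by dominated convergence). Together with
`lintegral_sub_leastSquares_mul_tail_sq_le`: the infimum of `∫_{Λ^{N+1}} |Ψ − g Θ(tail)|²` over bounded
measurable predictors `g` blind to `x_i` — the quantity summed over `i` in the crux `SquareSummableInfluence` —
EQUALS the closed-form least-squares defect `∫_{Λ^{N+1}} |Ψ − g⋆_i Θ(tail)|²`. [folklore] -/
theorem exists_bounded_blind_lintegral_le_leastSquares_add :
    ∀ (N : ℕ) (L : ℝ) (Θ : Config N → ℂ) (Ψ : Config (N + 1) → ℂ), Measurable Θ → Measurable Ψ →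
      (∫⁻ Z in boxN (N + 1) L, (‖Ψ Z‖₊ : ℝ≥0∞) ^ 2) ≠ ⊤ → ∀ (i : Fin N) (η : ℝ≥0∞), 0 < η →
    ∃ g : Config (N + 1) → ℂ, Measurable g ∧ (∃ M : ℝ, ∀ Z, ‖g Z‖ ≤ M) ∧
      (∀ Z x, g (Function.update Z (Fin.succ i) x) = g Z) ∧
      (∫⁻ Z in boxN (N + 1) L, (‖Ψ Z - g Z * Θ (Matrix.vecTail Z)‖₊ : ℝ≥0∞) ^ 2) ≤
        (∫⁻ Z in boxN (N + 1) L, (‖Ψ Z -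
          ((∫ x in box L, conj (Θ (Matrix.vecTail (Function.update Z (Fin.succ i) x))) *
            Ψ (Function.update Z (Fin.succ i) x)) /
          (((∫⁻ x in box L, (‖Θ (Matrix.vecTail (Function.update Z (Fin.succ i) x))‖₊ : ℝ≥0∞) ^ 2).toReal
            : ℝ) : ℂ)) *
            Θ (Matrix.vecTail Z)‖₊ : ℝ≥0∞) ^ 2) + η := by
  intro N L Θ Ψ hΘ hΨ hΨ2 i η hη
  -- the fibre maps and the least-squares predictor `g⋆`
  have hU : Measurable fun p : Config (N + 1) × Space => Function.update p.1 (Fin.succ i) p.2 :=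
    measurable_update'
  set θt : Config (N + 1) × Space → ℂ := fun p => Θ (Matrix.vecTail (Function.update p.1 (Fin.succ i) p.2))
    with hθt
  set ψt : Config (N + 1) × Space → ℂ := fun p => Ψ (Function.update p.1 (Fin.succ i) p.2) with hψt
  have hθtm : Measurable θt := hΘ.comp (measurable_vecTail.comp hU)
  have hψtm : Measurable ψt := hΨ.comp hU
  set m : Config (N + 1) → ℝ≥0∞ := fun Z => ∫⁻ x in box L, (‖θt (Z, x)‖₊ : ℝ≥0∞) ^ 2 with hm
  set o : Config (N + 1) → ℂ := fun Z => ∫ x in box L, conj (θt (Z, x)) * ψt (Z, x) with ho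
  set gs : Config (N + 1) → ℂ := fun Z => o Z / (((m Z).toReal : ℝ) : ℂ) with hgs
  have hmm : Measurable m := (hθtm.nnnorm.coe_nnreal_ennreal.pow_const 2).lintegral_prod_right'
  have hom : Measurable o := by
    have h : Measurable fun p : Config (N + 1) × Space => conj (θt p) * ψt p :=
      (Complex.continuous_conj.measurable.comp hθtm).mul hψtm
    exact (h.stronglyMeasurable.integral_prod_right' (ν := (volume : Measure Space).restrict (box L))).measurable
  have hgsm : Measurable gs := hom.div (Complex.measurable_ofReal.comp hmm.ennreal_toReal)
  have hmi : ∀ Z y, m (Function.update Z (Fin.succ i) y) = m Z := fun Z y => by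
    simp only [hm, hθt, Function.update_idem]
  have hoi : ∀ Z y, o (Function.update Z (Fin.succ i) y) = o Z := fun Z y => by
    simp only [ho, hθt, hψt, Function.update_idem]
  have hgsi : ∀ Z y, gs (Function.update Z (Fin.succ i) y) = gs Z := fun Z y => by
    simp only [hgs, hmi, hoi]
  have hΘt : Measurable fun Z : Config (N + 1) => Θ (Matrix.vecTail Z) := hΘ.comp measurable_vecTail
  set Fs : Config (N + 1) → ℝ≥0∞ := fun Z => (‖Ψ Z - gs Z * Θ (Matrix.vecTail Z)‖₊ : ℝ≥0∞) ^ 2 with hFs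
  have hFsm : Measurable Fs := (hΨ.sub (hgsm.mul hΘt)).nnnorm.coe_nnreal_ennreal.pow_const 2
  change ∃ g : Config (N + 1) → ℂ, Measurable g ∧ (∃ M : ℝ, ∀ Z, ‖g Z‖ ≤ M) ∧
      (∀ Z x, g (Function.update Z (Fin.succ i) x) = g Z) ∧
      ∫⁻ Z in boxN (N + 1) L, (‖Ψ Z - g Z * Θ (Matrix.vecTail Z)‖₊ : ℝ≥0∞) ^ 2 ≤
        (∫⁻ Z in boxN (N + 1) L, Fs Z) + η
  -- the truncations of `g⋆` and the tail masses `∫_{|g⋆| > n} |Ψ|²`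
  set gn : ℕ → Config (N + 1) → ℂ := fun n Z => if ‖gs Z‖ ≤ n then gs Z else 0 with hgn
  set f : ℕ → Config (N + 1) → ℝ≥0∞ := fun n =>
    Set.indicator {Z | (n : ℝ) < ‖gs Z‖} fun Z => (‖Ψ Z‖₊ : ℝ≥0∞) ^ 2 with hf
  have hAn : ∀ n : ℕ, MeasurableSet {Z : Config (N + 1) | (n : ℝ) < ‖gs Z‖} := fun n =>
    measurableSet_lt measurable_const hgsm.norm
  have hΨ2m : Measurable fun Z : Config (N + 1) => (‖Ψ Z‖₊ : ℝ≥0∞) ^ 2 :=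
    hΨ.nnnorm.coe_nnreal_ennreal.pow_const 2
  have hfm : ∀ n, Measurable (f n) := fun n => hΨ2m.indicator (hAn n)
  -- dominated convergence: the tail masses tend to `0`
  have hT : Tendsto (fun n => ∫⁻ Z in boxN (N + 1) L, f n Z) atTop (𝓝 0) := by
    have h := tendsto_lintegral_of_dominated_convergence
      (μ := (volume : Measure (Config (N + 1))).restrict (boxN (N + 1) L))
      (F := f) (f := fun _ => 0) (fun Z => (‖Ψ Z‖₊ : ℝ≥0∞) ^ 2) (fun n => hfm n)
      (fun n => Eventually.of_forall fun Z => by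
        simp only [hf]
        exact Set.indicator_le_self _ _ Z)
      hΨ2
      (Eventually.of_forall fun Z => by
        refine tendsto_const_nhds.congr' ?_
        refine Filter.eventually_atTop.2 ⟨⌈‖gs Z‖⌉₊, fun n hn => ?_⟩
        simp only [hf]
        rw [Set.indicator_of_notMem]
        simp only [Set.mem_setOf_eq, not_lt]
        exact (Nat.le_ceil _).trans (by exact_mod_cast hn))
    simpa only [lintegral_zero] using h
  obtain ⟨n, hn⟩ : ∃ n, ∫⁻ Z in boxN (N + 1) L, f n Z < η := (hT.eventually (gt_mem_nhds hη)).exists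
  refine ⟨gn n, Measurable.ite (measurableSet_le hgsm.norm measurable_const) hgsm measurable_const,
    ⟨n, fun Z => ?_⟩, fun Z x => ?_, ?_⟩
  · simp only [hgn]
    split_ifs with h
    · exact h
    · simp
  · simp only [hgn, hgsi]
  · -- pointwise `|Ψ − gₙ Θ(tail)|² ≤ |Ψ − g⋆ Θ(tail)|² + fₙ`, then integrate
    have hpt : ∀ Z, (‖Ψ Z - gn n Z * Θ (Matrix.vecTail Z)‖₊ : ℝ≥0∞) ^ 2 ≤ Fs Z + f n Z := by
      intro Z
      simp only [hgn, hf, hFs]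
      by_cases h : ‖gs Z‖ ≤ n
      · rw [if_pos h]
        exact le_self_add
      · rw [if_neg h, Set.indicator_of_mem (by simpa [Set.mem_setOf_eq, not_le] using h)]
        simp only [zero_mul, sub_zero]
        exact le_add_self
    calc ∫⁻ Z in boxN (N + 1) L, (‖Ψ Z - gn n Z * Θ (Matrix.vecTail Z)‖₊ : ℝ≥0∞) ^ 2
        ≤ ∫⁻ Z in boxN (N + 1) L, (Fs Z + f n Z) := lintegral_mono hpt
      _ = (∫⁻ Z in boxN (N + 1) L, Fs Z) + ∫⁻ Z in boxN (N + 1) L, f n Z := lintegral_add_left hFsm _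
      _ ≤ (∫⁻ Z in boxN (N + 1) L, Fs Z) + η := by gcongr

end Summit.AtomisticToContinuum.BoseEinsteinCondensation.Theorems.SquareSummableInfluence

end
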